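import Mathlib

/-!
# Surgery step for matching triples (crux `HyperoctahedralThreshold`, stmt-MatrixMultiplication-10883)

Line `refutation-local-symmetry`, lead prover-line-stmt-MatrixMultiplication-10883-1 (cycle 2): groundwork for the
BULK form of the matching lemma (L′) (crux NOTES §9 D1).  Given three fixed-point-free involutions `μ i` of `Fin n`
(three perfect matchings) and a vertex set `S` of even size, re-match the edges crossing the cut `(S, Sᶜ)` on each
side: the result `μ'` is again a triple of fixed-point-free involutions, it PRESERVES `S`, it agrees with `μ` at every
vertex whose `μ i`-edge does not cross the cut, and — the point of the construction — every commuting local triple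
for `μ'` whose support avoids the cut vertices is a commuting local triple for `μ` (`Surgery.localTriple_transport`).
With the √-superadditivity `√s + √(n-s) - √n ≥ 0.58√s` this is the induction step "sparse cut ⇒ recurse on both sides"
of the bulk architecture; the relabelling `S ≃ Fin |S|` and the induction itself are not done here.

Main statement: `surgery_step`.  Mathlib only; standard axioms.
-/

set_option linter.dupNamespace false

namespace Summit.MatrixMultiplication.MatrixMultiplication.Theorems.HyperoctahedralThreshold

namespace Surgery

variable {n : ℕ}

/-! The CUT SET of colour `μ` is `Finset.univ.filter (fun w => ¬ (w ∈ S ↔ μ w ∈ S))` (vertices whose `μ`-edge crosses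
`(S, Sᶜ)`); it is spelled out everywhere so that this file introduces no definition. -/

/-- Membership in the cut set. -/
theorem mem_cutSet {μ : Equiv.Perm (Fin n)} {S : Finset (Fin n)} {v : Fin n} :
    v ∈ (Finset.univ.filter (fun w => ¬ (w ∈ S ↔ μ w ∈ S))) ↔ ¬ (v ∈ S ↔ μ v ∈ S) := by
  simp

/-- The cut set is `μ`-invariant for an involution `μ`. -/
theorem mu_mem_cutSet {μ : Equiv.Perm (Fin n)} (hμ : μ * μ = 1) {S : Finset (Fin n)} {v : Fin n} :
    μ v ∈ (Finset.univ.filter (fun w => ¬ (w ∈ S ↔ μ w ∈ S))) ↔ v ∈ (Finset.univ.filter (fun w => ¬ (w ∈ S ↔ μ w ∈ S))) := by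
  have h2 : μ (μ v) = v := by
    have := congrArg (fun σ : Equiv.Perm (Fin n) => σ v) hμ
    simpa using this
  rw [mem_cutSet, mem_cutSet, h2]
  tauto

/-- On the complement of the cut set inside `S`, `μ` is a fixed-point-free involution, so that part of `S` has even
size; hence the part of the cut set inside `S` has the parity of `|S|`. -/
theorem even_card_cutSet_inter (μ : Equiv.Perm (Fin n)) (hμ : μ * μ = 1) (hfpf : ∀ v, μ v ≠ v)
    (S : Finset (Fin n)) (hS : Even S.card) : Even ((Finset.univ.filter (fun w => ¬ (w ∈ S ↔ μ w ∈ S))) ∩ S).card := by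
  classical
  -- the non-cut part of S
  set T : Finset (Fin n) := S.filter (fun v => μ v ∈ S) with hT
  have h2 : ∀ v, μ (μ v) = v := fun v => by
    have := congrArg (fun σ : Equiv.Perm (Fin n) => σ v) hμ
    simpa using this
  -- μ restricts to a fixed-point-free involution of T, so |T| is even
  have hTeven : Even T.card := by
    -- pair each v ∈ T with μ v ∈ T: the map is an involution without fixed points
    have hmapsTo : ∀ v ∈ T, μ v ∈ T := by
      intro v hv
      simp only [hT, Finset.mem_filter] at hv ⊢
      exact ⟨hv.2, by rw [h2]; exact hv.1⟩
    -- use the involution to show the cardinality is even via a sum over orbits of size 2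
    have key : ∀ s : Finset (Fin n), (∀ v ∈ s, μ v ∈ s) → Even s.card := by
      intro s
      induction s using Finset.strongInduction with
      | H s ih =>
        intro hs
        by_cases hempty : s = ∅
        · simp [hempty]
        · obtain ⟨v, hv⟩ := Finset.nonempty_iff_ne_empty.2 hempty
          have hμv : μ v ∈ s := hs v hv
          have hne : μ v ≠ v := hfpf v
          set s' := (s.erase v).erase (μ v) with hs'
          have hsub : s' ⊂ s := by
            refine Finset.ssubset_iff_subset_ne.2 ⟨?_, ?_⟩
            · intro x hx
              exact Finset.mem_of_mem_erase (Finset.mem_of_mem_erase hx)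
            · intro heq
              have : v ∈ s' := heq ▸ hv
              simp [hs'] at this
          have hs'cl : ∀ x ∈ s', μ x ∈ s' := by
            intro x hx
            simp only [hs', Finset.mem_erase] at hx ⊢
            obtain ⟨hx1, hx2, hx3⟩ := hx
            refine ⟨?_, ?_, hs x hx3⟩
            · intro h
              exact hx2 (by rw [← h2 x, h, h2])
            · intro h
              exact hx1 (by rw [← h2 x, h])
          have heven := ih s' hsub hs'cl
          have hcard : s.card = s'.card + 2 := by
            have h1 : (s.erase v).card = s.card - 1 := Finset.card_erase_of_mem hv
            have hμv' : μ v ∈ s.erase v := Finset.mem_erase.2 ⟨hne, hμv⟩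
            have h3 : s'.card = (s.erase v).card - 1 := Finset.card_erase_of_mem hμv'
            have hpos : 0 < s.card := Finset.card_pos.2 ⟨v, hv⟩
            have hpos' : 0 < (s.erase v).card := Finset.card_pos.2 ⟨μ v, hμv'⟩
            omega
          rw [hcard]
          exact heven.add (by decide)
    exact key T hmapsTo
  -- S = T ⊔ (cut ∩ S)
  have hdisj : Disjoint T ((Finset.univ.filter (fun w => ¬ (w ∈ S ↔ μ w ∈ S))) ∩ S) := by
    rw [Finset.disjoint_left]
    intro v hvT hvC
    simp only [hT, Finset.mem_filter] at hvT
    rw [Finset.mem_inter, mem_cutSet] at hvC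
    exact hvC.1 ⟨fun _ => hvT.2, fun _ => hvT.1⟩
  have hunion : T ∪ ((Finset.univ.filter (fun w => ¬ (w ∈ S ↔ μ w ∈ S))) ∩ S) = S := by
    ext v
    simp only [Finset.mem_union, hT, Finset.mem_filter, Finset.mem_inter, Finset.mem_univ, true_and]
    constructor
    · rintro (⟨h, _⟩ | ⟨_, h⟩) <;> exact h
    · intro hv
      by_cases hμ : μ v ∈ S
      · exact Or.inl ⟨hv, hμ⟩
      · exact Or.inr ⟨fun h => hμ (h.1 hv), hv⟩
  have hcard : S.card = T.card + ((Finset.univ.filter (fun w => ¬ (w ∈ S ↔ μ w ∈ S))) ∩ S).card := by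
    conv_lhs => rw [← hunion]
    exact Finset.card_union_of_disjoint hdisj
  rw [hcard] at hS
  exact (Nat.even_add.1 hS).1 hTeven

/-- An explicit fixed-point-free involution on a finite set of even size: index it by `Fin (2m)` and swap `2j ↔ 2j+1`. -/
theorem exists_fpf_involution_on (D : Finset (Fin n)) (hD : Even D.card) :
    ∃ τ : Equiv.Perm (Fin n), τ * τ = 1 ∧ (∀ v, v ∈ D → τ v ≠ v ∧ τ v ∈ D) ∧ (∀ v, v ∉ D → τ v = v) := by
  classical
  obtain ⟨m, hm⟩ := hD
  -- enumerate D
  let e : D ≃ Fin D.card := D.equivFin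
  -- the partner index: j ↦ j xor 1 (pairs 2k, 2k+1)
  have hcard2 : D.card = 2 * m := by omega
  let pidx : Fin D.card → Fin D.card := fun j =>
    ⟨if j.val % 2 = 0 then j.val + 1 else j.val - 1, by
      have := j.isLt
      split_ifs with h
      · omega
      · omega⟩
  have pidx_invol : ∀ j, pidx (pidx j) = j := by
    intro j
    apply Fin.ext
    simp only [pidx]
    have := j.isLt
    split_ifs with h1 h2 h2 <;> omega
  have pidx_ne : ∀ j, pidx j ≠ j := by
    intro j h
    have := congrArg Fin.val h
    simp only [pidx] at this
    split_ifs at this with h1 <;> omega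
  -- the map on Fin n
  let f : Fin n → Fin n := fun v => if hv : v ∈ D then (e.symm (pidx (e ⟨v, hv⟩))).1 else v
  have hf_mem : ∀ v (hv : v ∈ D), f v ∈ D := by
    intro v hv
    simp only [f, hv, dite_true]
    exact (e.symm (pidx (e ⟨v, hv⟩))).2
  have hf_val : ∀ v (hv : v ∈ D), f v = (e.symm (pidx (e ⟨v, hv⟩))).1 := by
    intro v hv
    simp only [f, hv, dite_true]
  have hf_invol : Function.Involutive f := by
    intro v
    by_cases hv : v ∈ D
    · have hfv := hf_mem v hv
      rw [hf_val (f v) hfv]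
      have : (⟨f v, hfv⟩ : D) = e.symm (pidx (e ⟨v, hv⟩)) := by
        apply Subtype.ext
        exact hf_val v hv
      rw [this, Equiv.apply_symm_apply, pidx_invol, Equiv.symm_apply_apply]
    · simp [f, hv]
  refine ⟨hf_invol.toPerm f, ?_, ?_, ?_⟩
  · exact Equiv.ext fun v => by simp [hf_invol v]
  · intro v hv
    refine ⟨?_, ?_⟩
    · intro h
      have h' : f v = v := h
      rw [hf_val v hv] at h'
      have : e.symm (pidx (e ⟨v, hv⟩)) = ⟨v, hv⟩ := Subtype.ext h'
      have := congrArg e this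
      rw [Equiv.apply_symm_apply] at this
      exact pidx_ne _ this
    · exact hf_mem v hv
  · intro v hv
    show f v = v
    simp [f, hv]

/-- Re-matching one colour across the cut. -/
theorem rematch_one (μ : Equiv.Perm (Fin n)) (hμ : μ * μ = 1) (hfpf : ∀ v, μ v ≠ v)
    (S : Finset (Fin n)) (hS : Even S.card) :
    ∃ μ' : Equiv.Perm (Fin n), μ' * μ' = 1 ∧ (∀ v, μ' v ≠ v) ∧ (∀ v, v ∈ S ↔ μ' v ∈ S) ∧
      (∀ v, (v ∈ S ↔ μ v ∈ S) → μ' v = μ v) := by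
  classical
  have h2 : ∀ v, μ (μ v) = v := fun v => by
    have := congrArg (fun σ : Equiv.Perm (Fin n) => σ v) hμ
    simpa using this
  -- the two halves of the cut set
  set Din : Finset (Fin n) := (Finset.univ.filter (fun w => ¬ (w ∈ S ↔ μ w ∈ S))) ∩ S with hDin
  set Dout : Finset (Fin n) := (Finset.univ.filter (fun w => ¬ (w ∈ S ↔ μ w ∈ S))) \ S with hDout
  have hDin_even : Even Din.card := even_card_cutSet_inter μ hμ hfpf S hS
  -- μ bijects Din with Dout, so Dout has the same (even) cardinality
  have hDout_even : Even Dout.card := by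
    have himage : Din.image μ = Dout := by
      ext w
      simp only [Finset.mem_image, hDin, hDout, Finset.mem_inter, Finset.mem_sdiff, mem_cutSet]
      constructor
      · rintro ⟨v, ⟨hvc, hvS⟩, rfl⟩
        refine ⟨?_, fun h => hvc ⟨fun _ => h, fun _ => hvS⟩⟩
        rw [h2]
        intro h
        exact hvc ⟨fun _ => by_contra fun h' => hvc ⟨fun _ => absurd hvS (fun _ => h'  (h.2 hvS)) , fun _ => hvS⟩, fun _ => hvS⟩
      · rintro ⟨hwc, hwS⟩
        refine ⟨μ w, ⟨?_, ?_⟩, h2 w⟩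
        · rw [h2]
          intro h
          exact hwc ⟨fun hw => absurd hw hwS, fun hμw => absurd (h.1 hμw) hwS⟩
        · by_contra hμS
          exact hwc ⟨fun hw => absurd hw hwS, fun hμw => absurd hμw hμS⟩
    have hinj : Set.InjOn μ (Din : Set (Fin n)) := fun a _ b _ h => μ.injective h
    rw [← himage, Finset.card_image_of_injOn hinj]
    exact hDin_even
  obtain ⟨τ₁, hτ₁inv, hτ₁D, hτ₁out⟩ := exists_fpf_involution_on Din hDin_even
  obtain ⟨τ₂, hτ₂inv, hτ₂D, hτ₂out⟩ := exists_fpf_involution_on Dout hDout_even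
  -- the new involution: τ₁ on Din, τ₂ on Dout, μ elsewhere
  have hdisj : ∀ v, ¬ (v ∈ Din ∧ v ∈ Dout) := by
    intro v ⟨h1, h2'⟩
    simp only [hDin, hDout, Finset.mem_inter, Finset.mem_sdiff] at h1 h2'
    exact h2'.2 h1.2
  let g : Fin n → Fin n := fun v => if v ∈ Din then τ₁ v else if v ∈ Dout then τ₂ v else μ v
  have hcut_iff : ∀ v, v ∈ (Finset.univ.filter (fun w => ¬ (w ∈ S ↔ μ w ∈ S))) ↔ v ∈ Din ∨ v ∈ Dout := by
    intro v
    simp only [hDin, hDout, Finset.mem_inter, Finset.mem_sdiff]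
    constructor
    · intro h; by_cases hv : v ∈ S; exact Or.inl ⟨h, hv⟩; exact Or.inr ⟨h, hv⟩
    · rintro (⟨h, _⟩ | ⟨h, _⟩) <;> exact h
  have hg : ∀ v, g (g v) = v := by
    intro v
    by_cases h1 : v ∈ Din
    · have hτv := (hτ₁D v h1).2
      simp only [g, h1, if_true, hτv]
      have := congrArg (fun σ : Equiv.Perm (Fin n) => σ v) hτ₁inv
      simpa using this
    · by_cases h2' : v ∈ Dout
      · have hτv := (hτ₂D v h2').2
        have hτv1 : τ₂ v ∉ Din := fun h => hdisj _ ⟨h, hτv⟩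
        simp only [g, h1, if_false, h2', if_true, hτv1, hτv]
        have := congrArg (fun σ : Equiv.Perm (Fin n) => σ v) hτ₂inv
        simpa using this
      · have hvc : v ∉ (Finset.univ.filter (fun w => ¬ (w ∈ S ↔ μ w ∈ S))) := fun h => by
          rcases (hcut_iff v).1 h with h | h
          exacts [h1 h, h2' h]
        have hμvc : μ v ∉ (Finset.univ.filter (fun w => ¬ (w ∈ S ↔ μ w ∈ S))) := by rwa [mu_mem_cutSet hμ]
        have hμ1 : μ v ∉ Din := fun h => hμvc ((hcut_iff _).2 (Or.inl h))
        have hμ2 : μ v ∉ Dout := fun h => hμvc ((hcut_iff _).2 (Or.inr h))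
        simp only [g, h1, h2', hμ1, hμ2, if_false, h2 v]
  have hginv : Function.Involutive g := hg
  refine ⟨hginv.toPerm g, ?_, ?_, ?_, ?_⟩
  · exact Equiv.ext fun v => by simp [hg v]
  · intro v
    show g v ≠ v
    by_cases h1 : v ∈ Din
    · simp only [g, h1, if_true]; exact (hτ₁D v h1).1
    · by_cases h2' : v ∈ Dout
      · simp only [g, h1, if_false, h2', if_true]; exact (hτ₂D v h2').1
      · simp only [g, h1, h2', if_false]; exact hfpf v
  · intro v
    show v ∈ S ↔ g v ∈ S
    by_cases h1 : v ∈ Din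
    · have hvS : v ∈ S := (Finset.mem_inter.1 h1).2
      have hτS : τ₁ v ∈ S := (Finset.mem_inter.1 (hτ₁D v h1).2).2
      simp only [g, h1, if_true]
      exact ⟨fun _ => hτS, fun _ => hvS⟩
    · by_cases h2' : v ∈ Dout
      · have hvS : v ∉ S := (Finset.mem_sdiff.1 h2').2
        have hτS : τ₂ v ∉ S := (Finset.mem_sdiff.1 (hτ₂D v h2').2).2
        simp only [g, h1, if_false, h2', if_true]
        exact ⟨fun h => absurd h hvS, fun h => absurd h hτS⟩
      · have hvc : v ∉ (Finset.univ.filter (fun w => ¬ (w ∈ S ↔ μ w ∈ S))) := fun h => by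
          rcases (hcut_iff v).1 h with h | h
          exacts [h1 h, h2' h]
        rw [mem_cutSet, not_not] at hvc
        simp only [g, h1, h2', if_false]
        exact hvc
  · intro v hv
    show g v = μ v
    have hvc : v ∉ (Finset.univ.filter (fun w => ¬ (w ∈ S ↔ μ w ∈ S))) := by rw [mem_cutSet, not_not]; exact hv
    have h1 : v ∉ Din := fun h => hvc ((hcut_iff _).2 (Or.inl h))
    have h2' : v ∉ Dout := fun h => hvc ((hcut_iff _).2 (Or.inr h))
    simp only [g, h1, h2', if_false]

/-- Transport of one commutation relation across the surgery: if `t` commutes with `μ'`, `μ'` agrees with `μ` off the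
cut set, the cut set is `μ`-invariant, and the support of `t` avoids the cut set, then `t` commutes with `μ`. -/
theorem comm_transport {S : Finset (Fin n)} (μ μ' t : Equiv.Perm (Fin n)) (hμ : μ * μ = 1)
    (hagree : ∀ v, v ∉ (Finset.univ.filter (fun w => ¬ (w ∈ S ↔ μ w ∈ S))) → μ' v = μ v) (hcomm : t * μ' = μ' * t)
    (hsupp : ∀ v, t v ≠ v → v ∉ (Finset.univ.filter (fun w => ¬ (w ∈ S ↔ μ w ∈ S)))) : t * μ = μ * t := by
  refine Equiv.ext fun v => ?_
  simp only [Equiv.Perm.coe_mul, Function.comp_apply]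
  have hc : ∀ w, t (μ' w) = μ' (t w) := fun w => by
    have := congrArg (fun σ : Equiv.Perm (Fin n) => σ w) hcomm
    simpa using this
  by_cases hv : v ∈ (Finset.univ.filter (fun w => ¬ (w ∈ S ↔ μ w ∈ S)))
  · -- then μ v is also a cut vertex; both are fixed by t
    have hμv : μ v ∈ (Finset.univ.filter (fun w => ¬ (w ∈ S ↔ μ w ∈ S))) := (mu_mem_cutSet hμ).2 hv
    have htv : t v = v := by by_contra h; exact hsupp v h hv
    have htμv : t (μ v) = μ v := by by_contra h; exact hsupp _ h hμv
    rw [htμv, htv]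
  · have h1 : μ v = μ' v := (hagree v hv).symm
    by_cases htv : t v = v
    · -- is μ v moved by t?  If so it is not a cut vertex and we compute through μ'
      rw [htv]
      by_cases htμ : t (μ v) = μ v
      · exact htμ
      · have hμvc : μ v ∉ (Finset.univ.filter (fun w => ¬ (w ∈ S ↔ μ w ∈ S))) := hsupp _ htμ
        rw [h1, hc v, htv]
    · have hvc' : t v ∉ (Finset.univ.filter (fun w => ¬ (w ∈ S ↔ μ w ∈ S))) := by
        intro h
        -- t v is moved by t as well (t (t v) ≠ t v unless t v = v)
        have : t (t v) ≠ t v := fun h' => htv (t.injective h')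
        exact hsupp _ this h
      rw [h1, hc v, hagree _ hvc']

/-- **Local triples transport back across the surgery.**  If `(a, b)` is a commuting local triple for `μ'`
(`a ∈ C(μ' 0)`, `b ∈ C(μ' 1)`, `ab ∈ C(μ' 2)`) whose support avoids every cut vertex, and `μ'` agrees with `μ`
off the cut sets, then `(a, b)` is a commuting local triple for `μ`. -/
theorem localTriple_transport (μ μ' : Fin 3 → Equiv.Perm (Fin n)) (hμ : ∀ i, μ i * μ i = 1)
    (S : Finset (Fin n)) (hagree : ∀ i v, v ∉ (Finset.univ.filter (fun w => ¬ (w ∈ S ↔ μ i w ∈ S))) → μ' i v = μ i v)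
    (a b : Equiv.Perm (Fin n))
    (h0 : a * μ' 0 = μ' 0 * a) (h1 : b * μ' 1 = μ' 1 * b) (h2 : a * b * μ' 2 = μ' 2 * (a * b))
    (hsupp : ∀ v, (a v ≠ v ∨ b v ≠ v) → ∀ i, v ∉ (Finset.univ.filter (fun w => ¬ (w ∈ S ↔ μ i w ∈ S)))) :
    a * μ 0 = μ 0 * a ∧ b * μ 1 = μ 1 * b ∧ a * b * μ 2 = μ 2 * (a * b) := by
  refine ⟨comm_transport (S := S) (μ 0) (μ' 0) a (hμ 0) (hagree 0) h0 (fun v hv => hsupp v (Or.inl hv) 0),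
    comm_transport (S := S) (μ 1) (μ' 1) b (hμ 1) (hagree 1) h1 (fun v hv => hsupp v (Or.inr hv) 1),
    comm_transport (S := S) (μ 2) (μ' 2) (a * b) (hμ 2) (hagree 2) h2 (fun v hv => ?_)⟩
  have : a v ≠ v ∨ b v ≠ v := by
    by_contra h
    push Not at h
    apply hv
    simp [Equiv.Perm.coe_mul, Function.comp_apply, h.2, h.1]
  exact hsupp v this 2

end Surgery

open Surgery in
/-- **Surgery step.**  For three fixed-point-free involutions `μ i` of `Fin n` and a vertex set `S` of even size there
are three fixed-point-free involutions `μ' i` which (i) preserve `S`, (ii) agree with `μ i` at every vertex `v`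
with `v ∈ S ↔ μ i v ∈ S` (no crossing), and (iii) such that every commuting local triple for `μ'` whose support
avoids the crossing vertices of all three colours is a commuting local triple for `μ`.  (The crossing vertices number
`2·e(S, Sᶜ)`; this is the re-matching used in the sparse-cut recursion of the bulk matching lemma, crux NOTES §9 D1.) -/
theorem surgery_step (n : ℕ) (μ : Fin 3 → Equiv.Perm (Fin n)) (hμ : ∀ i, μ i * μ i = 1 ∧ ∀ v, μ i v ≠ v)
    (S : Finset (Fin n)) (hS : Even S.card) :
    ∃ μ' : Fin 3 → Equiv.Perm (Fin n), (∀ i, μ' i * μ' i = 1 ∧ ∀ v, μ' i v ≠ v) ∧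
      (∀ i v, v ∈ S ↔ μ' i v ∈ S) ∧
      (∀ i v, (v ∈ S ↔ μ i v ∈ S) → μ' i v = μ i v) ∧
      (∀ a b : Equiv.Perm (Fin n),
        a * μ' 0 = μ' 0 * a → b * μ' 1 = μ' 1 * b → a * b * μ' 2 = μ' 2 * (a * b) →
        (∀ v, (a v ≠ v ∨ b v ≠ v) → ∀ i, (v ∈ S ↔ μ i v ∈ S)) →
        a * μ 0 = μ 0 * a ∧ b * μ 1 = μ 1 * b ∧ a * b * μ 2 = μ 2 * (a * b)) := by
  classical
  have hex : ∀ i, ∃ μ' : Equiv.Perm (Fin n), μ' * μ' = 1 ∧ (∀ v, μ' v ≠ v) ∧ (∀ v, v ∈ S ↔ μ' v ∈ S) ∧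
      (∀ v, (v ∈ S ↔ μ i v ∈ S) → μ' v = μ i v) :=
    fun i => rematch_one (μ i) (hμ i).1 (hμ i).2 S hS
  choose μ' hμ'inv hμ'fpf hμ'S hμ'agree using hex
  refine ⟨μ', fun i => ⟨hμ'inv i, hμ'fpf i⟩, hμ'S, hμ'agree, ?_⟩
  intro a b h0 h1 h2 hsupp
  have hagree : ∀ i v, v ∉ (Finset.univ.filter (fun w => ¬ (w ∈ S ↔ μ i w ∈ S))) → μ' i v = μ i v := by
    intro i v hv
    rw [mem_cutSet, not_not] at hv
    exact hμ'agree i v hv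
  refine localTriple_transport μ μ' (fun i => (hμ i).1) S hagree a b h0 h1 h2 ?_
  intro v hv i
  rw [mem_cutSet, not_not]
  exact hsupp v hv i

/-- **Registered form `stub_surgeryStep`** (sub-goal of the bulk architecture, crux NOTES §9 D1): `surgery_step` with the
hypotheses curried. -/
theorem stub_surgeryStep : ∀ (n : ℕ) (μ : Fin 3 → Equiv.Perm (Fin n)), (∀ i, μ i * μ i = 1 ∧ ∀ v, μ i v ≠ v) → ∀ (S : Finset (Fin n)), Even S.card → ∃ μ' : Fin 3 → Equiv.Perm (Fin n), (∀ i, μ' i * μ' i = 1 ∧ ∀ v, μ' i v ≠ v) ∧ (∀ i v, v ∈ S ↔ μ' i v ∈ S) ∧ (∀ i v, (v ∈ S ↔ μ i v ∈ S) → μ' i v = μ i v) ∧ (∀ a b : Equiv.Perm (Fin n), a * μ' 0 = μ' 0 * a → b * μ' 1 = μ' 1 * b → a * b * μ' 2 = μ' 2 * (a * b) → (∀ v, (a v ≠ v ∨ b v ≠ v) → ∀ i, (v ∈ S ↔ μ i v ∈ S)) → a * μ 0 = μ 0 * a ∧ b * μ 1 = μ 1 * b ∧ a * b * μ 2 = μ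 2 * (a * b)) :=
  fun n μ hμ S hS => surgery_step n μ hμ S hS

end Summit.MatrixMultiplication.MatrixMultiplication.Theorems.HyperoctahedralThreshold
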